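import Literature.Analysis.InnerProduct.IkedaIsospectralNonIsometricExistence
import Literature.Analysis.InnerProduct.FiveDimensionalIsospectralLensSpaces
import HarnessLib

/-!
# Ikeda's Theorem 3.1 (ii): for every prime `q ≥ 13` there are two `(q − 8)`-dimensional lens spaces with fundamental group of
# order `q` which are isospectral but not isometric (Ikeda 1980)

Layer `Literature/Analysis/InnerProduct`, namespace `Literature.Analysis.InnerProduct`; lane `lit-hodgefound`, prover seat
`lit-hodgefound-p06`, generation 45, row g45-#10. THEOREMS only (no definition, no instance, no notation, no named fact).
Companion of `IkedaIsospectralNonIsometricExistence.lean` (row g44-#13, Theorem 3.1 (i)) and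
`FiveDimensionalIsospectralLensSpaces.lean` (row g44-#4, Proposition 1.2 / 1.7 for `k = 3`).

## Source, verbatim (held text `paper:doi-10-24033-asens-1384`)

A. Ikeda, *On lens spaces which are isospectral but not isometric*, Ann. Sci. ÉNS (4) 13 (1980) 303–315, §3 (p. 311–312):
"**THEOREM 3.1.** — (i) let `q` be a prime not less than 11. Then there exist at least two `(q − 6)`-dimensional lens spaces
with fundamental groups of order `q` which are isospectral but not isometric; (ii) let `q` be a prime not less than 13. Then
there exist at least two `(q − 8)`-dimensional lens spaces with fundamental groups of order `q` which are isospectral but not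
isometric; (iii) let `q` be a prime not less than 17. Then there exist at least two `(q − 10)`-dimensional lens spaces with
fundamental groups of order `q` which are isospectral but not isometric. Proof. … (ii) let `q` be a prime with `q ≥ 13`. Then
`q₀ ≥ 6`. Put `k = 3` and `n = q₀ − 3`. Then `2n − 1 = q − 8`. On the other hand,
`|𝓛₀(q, n)| ≥ (1/q₀)·C(q₀, 3) = (q₀ − 1)(q₀ − 2)/6 ≥ 20/6 > 2 ≥ |J(q, 3)|`, which implies `Ψ̃_{q,3}` is not injective. …
Remark. — By Theorem 2.1, these lens spaces, which are isospectral but not isometric, are neither diffeomorphic nor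
homeomorphic to each other."

## What is proved, and how

The source's count `|𝓛₀(q, n)| > |J(q, 3)|` is replaced by an explicit witness of the non-injectivity of `Ψ̃_{q,3}`: the
classes of `(1, 2, 4)` and `(1, 2, 5) ∈ Ĩ₀(q, 3)`. Both have `|A_q(ω)| = 0` for `q ≥ 13` (none of `1 ± 2 ± 4 ∈ {7, −1, 3, −5}`,
`1 ± 2 ± 5 ∈ {8, −2, 4, −6}` is divisible by `q`), so by PROPOSITION 1.7 (row g44-#4's `IsIkedaWeights.ikedaPolynomial_fin_three_eq`)
`Ψ_{q,3}(1,2,4) = Ψ_{q,3}(1,2,5)`, and by PROPOSITION 2.6 (row g44-#3) the complementary weight systems `ω(1,2,4)`,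
`ω(1,2,5) ∈ Ĩ₀(q, q₀ − 3)` give ISOSPECTRAL lens spaces of dimension `2(q₀ − 3) − 1 = q − 8`; they are NOT EQUIVALENT (Theorem
2.1 (4)), since equivalence passes to complements (row g44-#13's `LensWeightsEquivalent.of_append`) and `(1, 2, 4) ≁ (1, 2, 5)`:
an equivalence `p_{σ(i)} ≡ e_i l s_i` gives, summing squares and fourth powers, `21 ≡ 30l²` and `273 ≡ 642l⁴ (mod q)`, whence
`q ∣ 642·21² − 900·273 = 37422 = 2·3⁵·7·11`, impossible for a prime `q ≥ 13`
(`not_lensWeightsEquivalent_one_two_four_one_two_five`). Main statement: `exists_isospectral_not_lensWeightsEquivalent_three`.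

## References

* [Ikeda1980] A. Ikeda, *On lens spaces which are isospectral but not isometric*, Ann. Sci. ÉNS (4) 13 (1980) 303–315,
  Theorem 3.1 (ii), Proposition 1.7, Proposition 2.6, Theorem 2.1, §1 (1.1)–(1.3).
-/

noncomputable section

namespace Literature.Analysis.InnerProduct

open Finset
open _root_.Real

variable {q : ℕ} [hq : Fact q.Prime]

/-! ### §1 The two weight systems `(1, 2, 4)`, `(1, 2, 5) ∈ Ĩ₀(q, 3)` -/

omit hq in
/-- `q ∤ m` for `0 < |m| < q`. [folklore] -/
private theorem not_dvd_of_abs_lt_t3 {m : ℤ} (hm : m ≠ 0) (hlt : |m| < q) : ¬((q : ℤ) ∣ m) := fun hd ↦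
  hm (Int.eq_zero_of_abs_lt_dvd hd hlt)

/-- An integer `r` with `1 ≤ r ≤ q − 1` is prime to the prime `q`. [folklore] -/
private theorem isCoprime_of_pos_of_lt_t3 {r : ℤ} (h1 : 1 ≤ r) (h2 : r < q) : IsCoprime r q := by
  lift r to ℕ using (by omega : 0 ≤ r)
  rw [Nat.isCoprime_iff_coprime]
  exact ((Nat.Prime.coprime_iff_not_dvd hq.out).mpr (Nat.not_dvd_of_pos_of_lt (by omega) (by omega))).symm

/-- `(1, 2, 4) ∈ Ĩ₀(q, 3)` for a prime `q ≥ 7`. [cite: Ikeda1980, §1 (1.1)] -/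
theorem isIkedaWeights_one_two_four (hq7 : 7 ≤ q) : IsIkedaWeights q ![1, 2, 4] where
  isCoprime i := by
    have hq' : (7 : ℤ) ≤ q := by exact_mod_cast hq7
    fin_cases i <;> exact isCoprime_of_pos_of_lt_t3 (by simp) (by simp; linarith)
  not_dvd_sub i j hij := by
    have hq' : (7 : ℤ) ≤ q := by exact_mod_cast hq7
    fin_cases i <;> fin_cases j <;>
      first | exact absurd rfl hij | exact not_dvd_of_abs_lt_t3 (by simp) (by simp; linarith)
  not_dvd_add i j hij := by
    have hq' : (7 : ℤ) ≤ q := by exact_mod_cast hq7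
    fin_cases i <;> fin_cases j <;>
      first | exact absurd rfl hij | exact not_dvd_of_abs_lt_t3 (by simp) (by simp; linarith)

/-- `(1, 2, 5) ∈ Ĩ₀(q, 3)` for a prime `q ≥ 11`. [cite: Ikeda1980, §1 (1.1)] -/
theorem isIkedaWeights_one_two_five (hq11 : 11 ≤ q) : IsIkedaWeights q ![1, 2, 5] where
  isCoprime i := by
    have hq' : (11 : ℤ) ≤ q := by exact_mod_cast hq11
    fin_cases i <;> exact isCoprime_of_pos_of_lt_t3 (by simp) (by simp; linarith)
  not_dvd_sub i j hij := by
    have hq' : (11 : ℤ) ≤ q := by exact_mod_cast hq11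
    fin_cases i <;> fin_cases j <;>
      first | exact absurd rfl hij | exact not_dvd_of_abs_lt_t3 (by simp) (by simp; linarith)
  not_dvd_add i j hij := by
    have hq' : (11 : ℤ) ≤ q := by exact_mod_cast hq11
    fin_cases i <;> fin_cases j <;>
      first | exact absurd rfl hij | exact not_dvd_of_abs_lt_t3 (by simp) (by simp; linarith)

omit hq in
/-- Reindexing a family of `Ĩ₀(q, N)` along an injection keeps it in `Ĩ₀` (the conditions (1.1) are on single weights and on
pairs). [cite: Ikeda1980, §1 (1.1)] -/
theorem IsIkedaWeights.comp {N m : ℕ} {W : Fin N → ℤ} (h : IsIkedaWeights q W) {f : Fin m → Fin N}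
    (hf : Function.Injective f) : IsIkedaWeights q (W ∘ f) where
  isCoprime i := h.isCoprime (f i)
  not_dvd_sub i j hij := h.not_dvd_sub (f i) (f j) (hf.ne hij)
  not_dvd_add i j hij := h.not_dvd_add (f i) (f j) (hf.ne hij)

omit hq in
/-- The two blocks of a concatenated family of `Ĩ₀(q, n + k)` may be exchanged. [cite: Ikeda1980, §1 (1.1)–(1.3)] -/
theorem IsIkedaWeights.append_comm {n k : ℕ} {a : Fin n → ℤ} {b : Fin k → ℤ} (h : IsIkedaWeights q (Fin.append a b)) :
    IsIkedaWeights q (Fin.append b a) := by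
  let e : Fin (k + n) ≃ Fin (n + k) := finSumFinEquiv.symm.trans ((Equiv.sumComm _ _).trans finSumFinEquiv)
  have he : Fin.append b a = Fin.append a b ∘ e := by
    ext i
    refine Fin.addCases (fun j ↦ ?_) (fun j ↦ ?_) i
    · simp [e]
    · simp [e]
  rw [he]
  exact h.comp e.injective

omit hq in
/-- A prime `q ≥ 13` does not divide `37422 = 2·3⁵·7·11`. [folklore] -/
private theorem not_dvd_37422_t3 (hp : q.Prime) (hq13 : 13 ≤ q) : ¬ q ∣ 37422 := by
  intro hd
  have h' : q ∣ 2 * (3 ^ 5 * (7 * 11)) := by norm_num; exact hd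
  rcases (Nat.Prime.dvd_mul hp).mp h' with h2 | h'
  · exact absurd (Nat.le_of_dvd two_pos h2) (by omega)
  rcases (Nat.Prime.dvd_mul hp).mp h' with h3 | h'
  · exact absurd (Nat.le_of_dvd (by norm_num) (hp.dvd_of_dvd_pow h3)) (by omega)
  rcases (Nat.Prime.dvd_mul hp).mp h' with h7 | h11
  · exact absurd (Nat.le_of_dvd (by norm_num) h7) (by omega)
  · exact absurd (Nat.le_of_dvd (by norm_num) h11) (by omega)

/-- **`(1, 2, 4)` and `(1, 2, 5)` are not equivalent in `Ĩ₀(q, 3)` for a prime `q ≥ 13`** (so `|𝓛₀(q, 3)| ≥ 2` classes with the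
same `|A_q| = 0`, i.e. `Ψ̃_{q,3}` is not injective — the inequality driving Theorem 3.1 (ii)): an equivalence
`p_{σ(i)} ≡ e_i l s_i` gives, on summing squares and fourth powers (`e_i² = 1`), `1 + 4 + 16 ≡ l²(1 + 4 + 25)` and
`1 + 16 + 256 ≡ l⁴(1 + 16 + 625)`, i.e. `21 ≡ 30l²`, `273 ≡ 642l⁴ (mod q)`, whence `642·21² ≡ 900·273`, `q ∣ 37422 = 2·3⁵·7·11`.
[cite: Ikeda1980, proof of Theorem 3.1 (ii) ("`Ψ̃_{q,3}` is not injective") with Proposition 1.7] -/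
theorem not_lensWeightsEquivalent_one_two_four_one_two_five (hq13 : 13 ≤ q) :
    ¬LensWeightsEquivalent q ![1, 2, 4] ![1, 2, 5] := by
  rintro ⟨l, e, he, σ, hσ⟩
  -- in `ℤ/q`
  have hc : ∀ i, (((![1, 2, 4] : Fin 3 → ℤ) (σ i) : ℤ) : ZMod q) =
      ((e i : ℤ) : ZMod q) * ((l : ℤ) : ZMod q) * (((![1, 2, 5] : Fin 3 → ℤ) i : ℤ) : ZMod q) := fun i ↦ by
    have := (ZMod.intCast_eq_intCast_iff _ _ _).mpr (hσ i)
    push_cast at this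
    exact this
  have he2 : ∀ i, ((e i : ℤ) : ZMod q) ^ 2 = 1 := fun i ↦ by rcases he i with h1 | h1 <;> simp [h1]
  have hsq : ∀ i, (((![1, 2, 4] : Fin 3 → ℤ) (σ i) : ℤ) : ZMod q) ^ 2 =
      ((l : ℤ) : ZMod q) ^ 2 * (((![1, 2, 5] : Fin 3 → ℤ) i : ℤ) : ZMod q) ^ 2 := fun i ↦ by
    rw [hc i]; linear_combination (((l : ℤ) : ZMod q) ^ 2 * (((![1, 2, 5] : Fin 3 → ℤ) i : ℤ) : ZMod q) ^ 2) * he2 i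
  have hfour : ∀ i, (((![1, 2, 4] : Fin 3 → ℤ) (σ i) : ℤ) : ZMod q) ^ 4 =
      ((l : ℤ) : ZMod q) ^ 4 * (((![1, 2, 5] : Fin 3 → ℤ) i : ℤ) : ZMod q) ^ 4 := fun i ↦ by
    rw [show (4 : ℕ) = 2 * 2 from rfl, pow_mul, hsq i]; ring
  -- the power sums are invariant under `σ`
  have s2 := Equiv.sum_comp σ (fun i ↦ (((![1, 2, 4] : Fin 3 → ℤ) i : ℤ) : ZMod q) ^ 2)
  have s4 := Equiv.sum_comp σ (fun i ↦ (((![1, 2, 4] : Fin 3 → ℤ) i : ℤ) : ZMod q) ^ 4)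
  simp only [hsq, hfour, ← Finset.mul_sum, Fin.sum_univ_three, Matrix.cons_val_zero, Matrix.cons_val_one,
    Matrix.cons_val_two, Matrix.tail_cons, Matrix.head_cons] at s2 s4
  push_cast at s2 s4
  -- `21 = 30 l²`, `273 = 642 l⁴` in `ℤ/q`, hence `37422 = 0`
  have h0 : ((37422 : ℤ) : ZMod q) = 0 := by
    push_cast
    linear_combination (-(642 * (21 + ((l : ℤ) : ZMod q) ^ 2 * 30))) * s2 + 900 * s4
  have hd : (q : ℤ) ∣ 37422 := (ZMod.intCast_zmod_eq_zero_iff_dvd _ _).mp h0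
  exact not_dvd_37422_t3 hq.out hq13 (by exact_mod_cast hd)

/-! ### §2 THEOREM 3.1 (ii) -/

/-- **IKEDA'S THEOREM 3.1 (ii), FOR EVERY PRIME `q ≥ 13`**: "let `q` be a prime not less than `13`. Then there exist at least two
`(q − 8)`-dimensional lens spaces with fundamental groups of order `q` which are isospectral but not isometric" — here:
`q = 2n + 9` and two weight systems `p, s ∈ Ĩ₀(q, n + 1)` (lens spaces `L(q : p)`, `L(q : s) = S^{2n+1}/ℤ_q` of dimension
`2n + 1 = q − 8`) with `dim E_m(L(q : p)) = dim E_m(L(q : s))` for every `m`, which are NOT equivalent in the sense of Theorem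
2.1 (4) — hence neither isometric nor diffeomorphic nor homeomorphic (Remark after Theorem 3.1). The two systems are the
complements of `(1, 2, 4)` and `(1, 2, 5) ∈ Ĩ₀(q, 3)` (both with `|A_q| = 0`: Proposition 1.7 and Proposition 2.6 give the
isospectrality; non-equivalence passes to complements). [cite: Ikeda1980, Theorem 3.1 (ii) and its proof (p. 311),
Proposition 1.7, Proposition 2.6, Theorem 2.1] -/
theorem exists_isospectral_not_lensWeightsEquivalent_three (hq13 : 13 ≤ q) :
    ∃ n : ℕ, q = 2 * n + 9 ∧ ∃ p s : Fin (n + 1) → ℤ, IsIkedaWeights q p ∧ IsIkedaWeights q s ∧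
      (∀ m, lensSpaceMultiplicity q p m = lensSpaceMultiplicity q s m) ∧ ¬LensWeightsEquivalent q p s := by
  have hq2 : q ≠ 2 := by omega
  obtain ⟨h, hh⟩ : Odd q := hq.out.odd_of_ne_two hq2
  obtain ⟨n, rfl⟩ : ∃ n, h = n + 4 := ⟨h - 4, by omega⟩
  refine ⟨n, by omega, ?_⟩
  have h124 := isIkedaWeights_one_two_four (q := q) (by omega)
  have h125 := isIkedaWeights_one_two_five (q := q) (by omega)
  obtain ⟨ω, hω⟩ := h124.exists_append (h := n + 4) (k := n + 1) (by omega) (by omega)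
  obtain ⟨ω', hω'⟩ := h125.exists_append (h := n + 4) (k := n + 1) (by omega) (by omega)
  refine ⟨ω, ω', hω.append_right, hω'.append_right, fun m ↦ ?_, fun heq ↦ ?_⟩
  · -- Proposition 2.6 with the complements `(1,2,4)`, `(1,2,5)`; Proposition 1.7 with `|A_q| = 0` on both sides
    refine (lensSpaceMultiplicity_eq_iff_ikedaPolynomial_eq (n := n) (k := 3) hq2 hω.append_comm hω'.append_comm
      (by omega)).mpr (h124.ikedaPolynomial_fin_three_eq h125 ?_) m
    have hq' : (13 : ℤ) ≤ q := by exact_mod_cast hq13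
    have nd : ∀ m : ℤ, m ≠ 0 → |m| < 13 → ¬ (q : ℤ) ∣ m := fun m hm hlt ↦
      not_dvd_of_abs_lt_t3 hm (lt_of_lt_of_le hlt hq')
    simp only [Matrix.cons_val_zero, Matrix.cons_val_one, Matrix.cons_val_two, Matrix.tail_cons, Matrix.head_cons]
    norm_num
    rw [if_neg (nd 7 (by norm_num) (by norm_num)), if_neg (nd 3 (by norm_num) (by norm_num)),
      if_neg (nd 5 (by norm_num) (by norm_num)), if_neg (nd 8 (by norm_num) (by norm_num)),
      if_neg (nd 2 (by norm_num) (by norm_num)), if_neg (nd 4 (by norm_num) (by norm_num)),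
      if_neg (nd 6 (by norm_num) (by norm_num)), if_neg (nd 1 (by norm_num) (by norm_num))]
  · exact not_lensWeightsEquivalent_one_two_four_one_two_five hq13
      (LensWeightsEquivalent.of_append hq2 (h := n + 4) (by omega) (by omega) hω hω' heq)

end Literature.Analysis.InnerProduct
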